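import Summits.Ventures.HodgeRepro2.T6InterfacePont
import Summits.Ventures.HodgeRepro2.T6InterfaceToy
import Summits.Ventures.HodgeRepro2.T6N

/-!
# T6InterfaceOfData — a `TransferShadow` from its EVEN data (the owners' glue target)

Layer III (TARGET-T6.md §2; t6-p2 l. 4496, lead l. 4535): the owners' glue (t6-p2's `T6A2Shadow` /
`T6A2ShadowData`) produces the fields of `TransferShadow` that a cohomological construction delivers —
`Alg`, `∫_B`, the surface shadow `HS` / `pull` / `∫_S` / `z` — together with the EVEN-degree form of the
Pontryagin identity (`alg_pont_even`: for algebraic `a`, `b` there is an algebraic `p` of the right degree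
with `∫_B p ∪ u = ∫_{B×B} (a ⊗ b) ∪ m^* u` on every even `u`). The fields `intBB`, `cop`, `pont` and their
Props are NOT geometric data for the glue: `∫_{B×B} := ∫_B ⊗ ∫_B` (`intBBOf`), `m^* :=` the shuffle coproduct
of the explicit model (`Toy.cop`), and `⋆ :=` the Poincaré dual of `u ↦ ∫_{B×B} (a ⊗ b) ∪ m^* u`
(`Pont.pontDual`), which satisfies `pont_spec` for ALL `a b u` by construction (`Pont.pontDual_spec`) and
equals the geometric `p` of `alg_pont_even` by the characterisation `Pont.eq_pontDual_of_spec_even` — so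
`alg_pont` transports along that equality. `TransferShadow.ofData` packages this; its projections are `rfl`
and the two closing Props unfold to statements in the data's own words (`weilClassesAlgebraic_ofData_iff`,
`periodN_ofData_iff`). Rebuilt by t6-lead g2 from the l. 4535 shape (the g0 sources were not in HOME).
§8(d): uses an L-value-free non-vanishing device: NO.
-/

namespace Summit.Ventures.HodgeRepro2.T6.OfData

open ExteriorAlgebra ExteriorDuality GradedTensorProduct Parity
open scoped TensorProduct

variable {K : Type*} [Field K] [NumberField K]

variable (K) in
/-- `∫_{B×B} := ∫_B ⊗ ∫_B` on the Künneth model `HBB K`, for a given `∫_B = f` (Fubini; Bredon Thm. VI.5.4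
/ product orientation, TIER4 (A5.2.0)). -/
noncomputable def intBBOf (f : HB K →ₗ[ℚ] ℚ) : HBB K →ₗ[ℚ] ℚ :=
  TensorProduct.lift ((LinearMap.mul ℚ ℚ).compl₁₂ f f) ∘ₗ
    (of ℚ (fun i : ℕ => ⋀[ℚ]^i (H1 K)) (fun i : ℕ => ⋀[ℚ]^i (H1 K))).symm.toLinearMap

/-- `intBBOf f (a ᵍ⊗ₜ b) = f a * f b`. -/
lemma intBBOf_tmul' (f : HB K →ₗ[ℚ] ℚ) (a b : HB K) : intBBOf K f (a ᵍ⊗ₜ b) = f a * f b := by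
  simp [intBBOf, GradedTensorProduct.tmul]

/-- `intBB_tmul` for `intBBOf f`: `∫_{B×B} (pr_1^* a ∪ pr_2^* b) = ∫_B a · ∫_B b`. -/
lemma intBBOf_tmul (f : HB K →ₗ[ℚ] ℚ) (a b : HB K) :
    intBBOf K f (inl K a * inr K b) = f a * f b := by
  rw [inl_mul_inr, intBBOf_tmul']

/-- THE EVEN DATA of a transfer shadow: the fields of `TransferShadow` minus `intBB` / `intBB_tmul` / `cop`
/ `cop_ι` / `pont` / `pont_spec` / `alg_pont`, plus the even-degree Pontryagin identity `alg_pont_even`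
(t6-p2's `exists_pont_char`: Lemma A4.1.1(ii) for `m`, `integral_gysin_mul`). Field names as in
`TransferShadow`. -/
structure ShadowData (F : FaceSetting K) where
  /-- `Alg k ⊂ H^{2k}(B, ℚ)`: the ℚ-span of the classes of codimension-`k` subvarieties. -/
  Alg : ℕ → Submodule ℚ (HB K)
  /-- algebraic classes have the right degree -/
  alg_deg : ∀ k, Alg k ≤ degB K (2 * k)
  /-- the fundamental class: `1 = cl(B) ∈ Alg 0` -/
  alg_one : (1 : HB K) ∈ Alg 0
  /-- `Alg` is closed under cup product (Fulton Cor. 19.2(b)) -/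
  alg_mul : ∀ {k l : ℕ} {a b : HB K}, a ∈ Alg k → b ∈ Alg l → a * b ∈ Alg (k + l)
  /-- `[x]^*` preserves algebraic classes (Fulton Cor. 19.2(b)) -/
  alg_pull : ∀ (x : K) {k : ℕ} {a : HB K}, a ∈ Alg k → pullEndo K x a ∈ Alg k
  /-- Lefschetz (1,1) on `B` -/
  alg_lefschetz : ∀ a ∈ degB K 2, extC K a ∈ hodge F 1 1 → a ∈ Alg 1
  /-- `∫_B : H^*(B, ℚ) → ℚ` -/
  intB : HB K →ₗ[ℚ] ℚ
  /-- `∫_B` kills every degree but `24` -/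
  intB_deg : ∀ k ≠ 24, ∀ a ∈ degB K k, intB a = 0
  /-- `∫_B` is non-zero in the top degree -/
  intB_ne_zero : ∃ a ∈ degB K 24, intB a ≠ 0
  /-- the EVEN form of the Pontryagin identity: for algebraic `a`, `b` there is an algebraic `p` of degree
  `2(k + l - 12)` with `∫_B p ∪ u = ∫_{B×B} (a ⊗ b) ∪ m^* u` for every even `u`, where
  `∫_{B×B} = ∫_B ⊗ ∫_B` and `m^*` is the shuffle coproduct of the explicit model. -/
  alg_pont_even : ∀ {k l : ℕ} {a b : HB K}, a ∈ Alg k → b ∈ Alg l →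
    ∃ p ∈ Alg (k + l - 12), ∀ (j : ℕ) (u : HB K), u ∈ degB K (2 * j) →
      intB (p * u) = intBBOf K intB (inl K a * inr K b * Toy.cop K u)
  /-- the surface shadow `H^*(S, ℂ)` -/
  HS : Type
  [instRingHS : Ring HS]
  [instAlgHS : Algebra ℂ HS]
  /-- `f^* : H^*(B, ℂ) → H^*(S, ℂ)` -/
  pull : HBC K →ₐ[ℂ] HS
  /-- `∫_S : H^*(S, ℂ) → ℂ` -/
  intS : HS →ₗ[ℂ] ℂ
  /-- the Gysin class `z = f_*(1_S) ∈ H^{20}(B, ℚ)` -/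
  z : HB K
  z_deg : z ∈ degB K 20
  /-- `z` is algebraic -/
  z_alg : z ∈ Alg 10
  /-- the projection formula `∫_B z ∪ u = ∫_S f^* u` -/
  z_proj : ∀ u : HB K, ((intB (z * u) : ℚ) : ℂ) = intS (pull (extC K u))

namespace ShadowData

variable {F : FaceSetting K} (S : ShadowData F)

/-- the ring structure of the surface cohomology `HS` (field) -/
instance : Ring S.HS := S.instRingHS
/-- the `ℂ`-algebra structure of `HS` (field) -/
instance : Algebra ℂ S.HS := S.instAlgHS

/-- The Pontryagin product of the data: the Poincaré dual of `u ↦ ∫_{B×B} (a ⊗ b) ∪ m^* u`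
(`Pont.pontDual` on the basis `Toy.b1 K`). -/
noncomputable def pont : HB K →ₗ[ℚ] HB K →ₗ[ℚ] HB K :=
  Pont.pontDual (Toy.b1 K) S.intB (intBBOf K S.intB) (Toy.cop K)

/-- `pont_spec` for ALL `a b u`, by construction. -/
theorem pont_spec (a b u : HB K) :
    S.intB (S.pont a b * u) = intBBOf K S.intB (inl K a * inr K b * Toy.cop K u) :=
  Pont.pontDual_spec (Toy.b1 K) S.intB (intBBOf K S.intB) (Toy.cop K) S.intB_deg (Toy.card_index F)
    S.intB_ne_zero a b u

/-- `alg_pont`: the geometric `p` of `alg_pont_even` IS `pont a b` (characterisation on even classes), so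
the Pontryagin product of algebraic classes is algebraic. -/
theorem alg_pont {k l : ℕ} {a b : HB K} (ha : a ∈ S.Alg k) (hb : b ∈ S.Alg l) :
    S.pont a b ∈ S.Alg (k + l - 12) := by
  obtain ⟨p, hp, hspec⟩ := S.alg_pont_even ha hb
  have hpe : p = S.pont a b :=
    Pont.eq_pontDual_of_spec_even (Toy.b1 K) S.intB (intBBOf K S.intB) (Toy.cop K) S.intB_deg
      (Toy.card_index F) S.intB_ne_zero (intBBOf_tmul S.intB) Toy.cop_ι (S.alg_deg k ha)
      (S.alg_deg l hb) (S.alg_deg _ hp) hspec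
  rw [← hpe]
  exact hp

end ShadowData

/-- THE TRANSFER SHADOW OF THE DATA: `intBB := ∫_B ⊗ ∫_B`, `cop :=` the shuffle coproduct,
`pont :=` its Poincaré dual; everything else is the data's own field. -/
noncomputable def _root_.Summit.Ventures.HodgeRepro2.T6.TransferShadow.ofData {F : FaceSetting K}
    (S : ShadowData F) : TransferShadow F where
  Alg := S.Alg
  alg_deg := S.alg_deg
  alg_one := S.alg_one
  alg_mul := S.alg_mul
  alg_pull := S.alg_pull
  alg_lefschetz := S.alg_lefschetz
  intB := S.intB
  intB_deg := S.intB_deg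
  intB_ne_zero := S.intB_ne_zero
  intBB := intBBOf K S.intB
  intBB_tmul := intBBOf_tmul S.intB
  cop := Toy.cop K
  cop_ι := Toy.cop_ι
  pont := S.pont
  pont_spec := S.pont_spec
  alg_pont := S.alg_pont
  HS := S.HS
  pull := S.pull
  intS := S.intS
  z := S.z
  z_deg := S.z_deg
  z_alg := S.z_alg
  z_proj := S.z_proj

variable {F : FaceSetting K} (S : ShadowData F)

/-- The algebraic-class predicate of `ofData S` is the data's `Alg`. -/
@[simp] lemma ofData_Alg : (TransferShadow.ofData S).Alg = S.Alg := rfl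
/-- The Betti integral of `ofData S` is the data's `intB`. -/
@[simp] lemma ofData_intB : (TransferShadow.ofData S).intB = S.intB := rfl
/-- The singular integral of `ofData S` is the data's `intS`. -/
@[simp] lemma ofData_intS : (TransferShadow.ofData S).intS = S.intS := rfl
/-- The pull-back of `ofData S` is the data's `pull`. -/
@[simp] lemma ofData_pull : (TransferShadow.ofData S).pull = S.pull := rfl
/-- The distinguished class of `ofData S` is the data's `z`. -/
@[simp] lemma ofData_z : (TransferShadow.ofData S).z = S.z := rfl
/-- The Pontryagin product of `ofData S` is the `Pont.pontDual` built from `S.intB`. -/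
@[simp] lemma ofData_pont : (TransferShadow.ofData S).pont = S.pont := rfl
/-- The box integral of `ofData S` is `intBBOf K S.intB` (the tensor-square functional of `S.intB`). -/
@[simp] lemma ofData_intBB : (TransferShadow.ofData S).intBB = intBBOf K S.intB := rfl
/-- The coproduct of `ofData S` is the toy coproduct `Toy.cop K`. -/
@[simp] lemma ofData_cop : (TransferShadow.ofData S).cop = Toy.cop K := rfl

/-- The conclusion of Theorem A on `ofData S`, in the data's words. -/
theorem weilClassesAlgebraic_ofData_iff :
    WeilClassesAlgebraic (TransferShadow.ofData S) ↔ ∀ w ∈ weilQ K, w ∈ S.Alg 2 :=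
  Iff.rfl

/-- The displayed (N) on `ofData S`, in the data's surface words. -/
theorem periodN_ofData_iff :
    Hyp.PeriodN (TransferShadow.ofData S) ↔
      ∃ σ : K →+* ℂ, ∃ e : Fin 4 → H1C K, (∀ i, e i ∈ eigenLine K i σ) ∧
        S.intS (S.pull (ι ℂ (e 0) * ι ℂ (e 1) * ι ℂ (e 2) * ι ℂ (e 3))) ≠ 0 :=
  Iff.rfl

/-- The internal period input on `ofData S`. -/
theorem periodInputN_ofData_iff :
    PeriodInputN (TransferShadow.ofData S) ↔ ∃ w ∈ weilC F, S.intS (S.pull w) ≠ 0 :=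
  Iff.rfl

end Summit.Ventures.HodgeRepro2.T6.OfData
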